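import Literature.NumberTheory.EllipticCurves.WeierstrassSchemePieces
import Literature.NumberTheory.EllipticCurves.WeierstrassSchemePointsAdd
import Literature.NumberTheory.EllipticCurves.WeierstrassAddAtlas
import Literature.NumberTheory.EllipticCurves.WeierstrassAddLawTwoMap
import Literature.AlgebraicGeometry.Motives.ProjectiveSpaceRingPointsRigidity
import HarnessLib

/-!
# The law charts of the addition morphism of a Weierstrass cubic

For an elliptic curve `W` over a field `K` with plane cubic `E_W ⊂ ℙ²_K`, this file constructs an
**atlas of law charts** (`EllipticCurves/WeierstrassAddAtlas.AddAtlas`) for the chord–tangent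
addition, hence the addition morphism `E_W ×_K E_W → E_W` (Silverman, *AEC* III.3.6), from the
**complete system of two bidegree-`(2,2)` addition laws** of Bosma–Lenstra (Mathlib's `addXYZ` and
the `add₂XYZ` of `EllipticCurves/WeierstrassAddLawTwo`, `WeierstrassAddLawsComplete`):

* on the affine piece `Spec (A_c ⊗_K A_d) ⊂ E_W ×_K E_W` (`EllipticCurves/WeierstrassSchemePieces`) the
  two universal points have homogeneous coordinates `lawP = (x_j/x_c ⊗ 1)ⱼ`, `lawQ = (1 ⊗ x_j/x_d)ⱼ`,
  and the `i`-th law gives a vector `lawVec c d i ∈ (A_c ⊗ A_d)³` (`WeierstrassCurve.law`), which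
  satisfies the Weierstrass equation (`aeval_lawVec`: checked in the residue fields of the reduced ring
  `A_c ⊗ A_d`, where it is the field-level `equation_addXYZ` / `equation_add₂XYZ`);
* the **law chart** `lawChart c d i e` (`c, d, e ∈ {0,1,2}`, `i ∈ {0,1}`): source the basic open
  `Spec (A_c ⊗ A_d)[1/g]`, `g` the `e`-th coordinate of `lawVec c d i`, value morphism
  `Spec (A_c ⊗ A_d)[1/g] → Spec A_e → E_W` given by the vector `lawVec/g` through the universal property
  of the chart ring `A_e` (`Motives/HypersurfaceCharts.liftVec`); on `K̄`-points it computes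
  `pr₁ + pr₂` (`lawChart`'s `isAddition`, from `toGeomPoint_schemePoint_addXYZ/add₂XYZ` of
  `EllipticCurves/WeierstrassSchemePointsAdd`);
* **the 54 law charts cover `E_W ×_K E_W`** (`lawCharts_cover`): at every point of a piece one of
  the two laws is non-zero in the residue field (completeness, `addXYZ_ne_zero_or_add₂XYZ_ne_zero`),
  so one of its coordinates is a unit nearby;
* `WeierstrassCurve.addAtlas W`, and `WeierstrassCurve.addHom W := W.addAtlas.addHom` with
  `lift_pointEquiv_comp_addHom : ⟨[P], [Q]⟩ ≫ addHom = [P + Q]`.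

## References

* J. H. Silverman, *The Arithmetic of Elliptic Curves*, 2nd ed. (2009): III.3.6, Remark 3.6.1. [SilvermanAEC2009]
* W. Bosma, H. W. Lenstra, J. Number Theory 53 (1995), 229–240: Theorem 2. [BosmaLenstra1995]
-/

noncomputable section

open CategoryTheory AlgebraicGeometry MonoidalCategory CartesianMonoidalCategory Limits MvPolynomial
open Literature.AlgebraicGeometry.Motives Literature.NumberTheory.EllipticCurves
open scoped TensorProduct Classical

universe u

-- tree idiom for scheme-level rewriting through the `Over`/pullback API (cf. `Motives/ProjSubscheme*`)
set_option backward.isDefEq.respectTransparency false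

namespace WeierstrassCurve

variable {K : Type u} [Field K] (W : WeierstrassCurve K)

attribute [local instance] MvPolynomial.gradedAlgebra ProjBaseChange.algebraBase

/-! ### The two laws over a `K`-algebra -/

section Law

variable (B : Type u) [CommRing B] [Algebra K B]

/-- The `i`-th addition law over the `K`-algebra `B` (`i = 0`: Mathlib's `addXYZ`; `i = 1`: the
Bosma–Lenstra second law `add₂XYZ`), applied to two coordinate vectors. [cite: BosmaLenstra1995, Theorem 2] -/
def law (i : Fin 2) (P Q : Fin 3 → B) : Fin 3 → B :=
  ![(W.baseChange B).toProjective.addXYZ P Q, (W.baseChange B).toProjective.add₂XYZ P Q] i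

/-- `law 0 = addXYZ`. [folklore] -/
@[simp]
theorem law_zero (P Q : Fin 3 → B) : W.law B 0 P Q = (W.baseChange B).toProjective.addXYZ P Q := rfl

/-- `law 1 = add₂XYZ`. [folklore] -/
@[simp]
theorem law_one (P Q : Fin 3 → B) : W.law B 1 P Q = (W.baseChange B).toProjective.add₂XYZ P Q := rfl

variable {B} {B' : Type u} [CommRing B'] [Algebra K B']

/-- **The laws commute with `K`-algebra maps** (Mathlib `baseChange_addXYZ`, and `baseChange_add₂XYZ`
of `EllipticCurves/WeierstrassAddLawTwoMap`). [folklore] -/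
theorem comp_law (φ : B →ₐ[K] B') (i : Fin 2) (P Q : Fin 3 → B) :
    φ ∘ W.law B i P Q = W.law B' i (φ ∘ P) (φ ∘ Q) := by
  fin_cases i
  · exact (Projective.baseChange_addXYZ (W' := W) φ P Q).symm
  · exact (Projective.baseChange_add₂XYZ (W' := W) φ P Q).symm

end Law

/-! ### The laws on field-valued points -/

section FieldLaw

variable {L : Type u} [Field L] [Algebra K L] [W.IsElliptic]

/-- The `i`-th law at nonsingular (= all, `W` elliptic) points of `E_W(L)` satisfies the Weierstrass
equation (`equation_addXYZ`, `equation_add₂XYZ`). [folklore] -/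
theorem equation_law (i : Fin 2) {P Q : Fin 3 → L} (hP0 : P ≠ 0)
    (hPe : (W.baseChange L).toProjective.Equation P) (hQ0 : Q ≠ 0)
    (hQe : (W.baseChange L).toProjective.Equation Q) :
    (W.baseChange L).toProjective.Equation (W.law L i P Q) := by
  have hP := W.nonsingular_of_equation' hP0 hPe
  have hQ := W.nonsingular_of_equation' hQ0 hQe
  fin_cases i
  · exact equation_addXYZ (V := W.baseChange L) hP hQ
  · exact equation_add₂XYZ (V := W.baseChange L) hP hQ

/-- **Completeness of the two laws**: at every pair of points of `E_W(L)` one of the two laws is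
non-zero (Bosma–Lenstra 1995, Theorem 2; `addXYZ_ne_zero_or_add₂XYZ_ne_zero`).
[cite: BosmaLenstra1995, Theorem 2] -/
theorem exists_law_ne_zero {P Q : Fin 3 → L} (hP0 : P ≠ 0)
    (hPe : (W.baseChange L).toProjective.Equation P) (hQ0 : Q ≠ 0)
    (hQe : (W.baseChange L).toProjective.Equation Q) : ∃ i : Fin 2, W.law L i P Q ≠ 0 := by
  rcases Projective.addXYZ_ne_zero_or_add₂XYZ_ne_zero (W.nonsingular_of_equation' hP0 hPe)
    (W.nonsingular_of_equation' hQ0 hQe) with h | h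
  · exact ⟨0, h⟩
  · exact ⟨1, h⟩

omit [Algebra K L] in
/-- **`[law i P Q] = [P] + [Q]` in `W.geomPoints`** wherever the law is non-zero
(`toGeomPoint_schemePoint_addXYZ`, `toGeomPoint_schemePoint_add₂XYZ`). [cite: SilvermanAEC2009, III.3.6] -/
theorem toGeomPoint_schemePoint_law (i : Fin 2) {P Q : Fin 3 → AlgebraicClosure K}
    (hP0 : P ≠ 0) (hPe : (W.baseChange (AlgebraicClosure K)).toProjective.Equation P)
    (hQ0 : Q ≠ 0) (hQe : (W.baseChange (AlgebraicClosure K)).toProjective.Equation Q)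
    (h0 : W.law (AlgebraicClosure K) i P Q ≠ 0)
    (he : (W.baseChange (AlgebraicClosure K)).toProjective.Equation (W.law (AlgebraicClosure K) i P Q)) :
    W.toGeomPoint (W.schemePoint (W.law (AlgebraicClosure K) i P Q) h0 he) =
      W.toGeomPoint (W.schemePoint P hP0 hPe) + W.toGeomPoint (W.schemePoint Q hQ0 hQe) := by
  fin_cases i
  · exact W.toGeomPoint_schemePoint_addXYZ hP0 hPe hQ0 hQe h0 he
  · exact W.toGeomPoint_schemePoint_add₂XYZ hP0 hPe hQ0 hQe h0 he

end FieldLaw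

/-! ### The law vectors on the pieces -/

section LawVec

variable (c d : Fin 3)

/-- Homogeneous coordinates `(x_j/x_c ⊗ 1)ⱼ` of the first universal point on the piece `Spec (A_c ⊗ A_d)`.
[folklore] -/
def lawP : Fin 3 → W.PieceRing c d := fun j ↦ W.ctaut c j ⊗ₜ[K] 1

/-- Homogeneous coordinates `(1 ⊗ x_j/x_d)ⱼ` of the second universal point on the piece. [folklore] -/
def lawQ : Fin 3 → W.PieceRing c d := fun j ↦ 1 ⊗ₜ[K] W.ctaut d j

/-- The `i`-th law vector on the piece `Spec (A_c ⊗ A_d)`. [cite: BosmaLenstra1995, Theorem 2] -/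
def lawVec (i : Fin 2) : Fin 3 → W.PieceRing c d := W.law (W.PieceRing c d) i (W.lawP c d) (W.lawQ c d)

variable {c d} {B : Type u} [CommRing B] [Algebra K B] (φ : W.PieceRing c d →ₐ[K] B)

/-- `φ ∘ lawP` is the coordinate vector of the `B`-point `φ ∘ includeLeft` of the chart `c`. [folklore] -/
theorem comp_lawP : φ ∘ W.lawP c d = fun j ↦ (φ.comp Algebra.TensorProduct.includeLeft) (W.ctaut c j) := rfl

/-- `φ ∘ lawQ` is the coordinate vector of the `B`-point `φ ∘ includeRight` of the chart `d`. [folklore] -/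
theorem comp_lawQ : φ ∘ W.lawQ c d = fun j ↦ (φ.comp Algebra.TensorProduct.includeRight) (W.ctaut d j) := rfl

/-- The law vector under a `K`-algebra map is the law of the image points. [folklore] -/
theorem comp_lawVec (i : Fin 2) : φ ∘ W.lawVec c d i = W.law B i (φ ∘ W.lawP c d) (φ ∘ W.lawQ c d) :=
  W.comp_law φ i _ _

variable {L : Type u} [Field L] [Algebra K L] (ψ : W.PieceRing c d →ₐ[K] L)

/-- Over a field, `ψ ∘ lawP ≠ 0`. [folklore] -/
theorem comp_lawP_ne_zero : ψ ∘ W.lawP c d ≠ 0 := by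
  rw [comp_lawP]; exact W.crVec_ne_zero c _

/-- Over a field, `ψ ∘ lawQ ≠ 0`. [folklore] -/
theorem comp_lawQ_ne_zero : ψ ∘ W.lawQ c d ≠ 0 := by
  rw [comp_lawQ]; exact W.crVec_ne_zero d _

/-- Over a field, `ψ ∘ lawP` satisfies the Weierstrass equation. [folklore] -/
theorem equation_comp_lawP : (W.baseChange L).toProjective.Equation (ψ ∘ W.lawP c d) := by
  rw [comp_lawP]; exact W.equation_crVec c _

/-- Over a field, `ψ ∘ lawQ` satisfies the Weierstrass equation. [folklore] -/
theorem equation_comp_lawQ : (W.baseChange L).toProjective.Equation (ψ ∘ W.lawQ c d) := by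
  rw [comp_lawQ]; exact W.equation_crVec d _

/-- An element of a reduced ring vanishing in `Frac(R/𝔭)` for every prime `𝔭` is zero (generic helper,
in the directory namespace). [folklore] -/
theorem _root_.Literature.NumberTheory.EllipticCurves.eq_zero_of_forall_toResidueDomainField
    {K : Type u} [Field K] {R : Type u} [CommRing R] [Algebra K R] [IsReduced R]
    {x : R} (h : ∀ 𝔭 : PrimeSpectrum R, ProjectiveSpace.toResidueDomainField K 𝔭 x = 0) : x = 0 := by
  refine IsReduced.eq_zero x (nilpotent_iff_mem_prime.mpr fun J hJ ↦ ?_)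
  exact (ProjectiveSpace.toResidueDomainField_eq_zero_iff (k := K) ⟨J, hJ⟩ x).mp (h ⟨J, hJ⟩)

variable [W.IsElliptic]

/-- **The law vectors lie on the curve**: `F(lawVec c d i) = 0` in `A_c ⊗ A_d` (a reduced ring: check
in its residue fields, where it is `equation_law`). [cite: SilvermanAEC2009, III.3.6] -/
theorem aeval_lawVec (i : Fin 2) : aeval (W.lawVec c d i) W.toProjective.polynomial = 0 := by
  refine eq_zero_of_forall_toResidueDomainField (K := K) fun 𝔭 ↦ ?_
  set ψ := ProjectiveSpace.toResidueDomainField K 𝔭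
  have h : ψ (aeval (W.lawVec c d i) W.toProjective.polynomial) =
      aeval (ψ ∘ W.lawVec c d i) W.toProjective.polynomial := by
    rw [← AlgHom.comp_apply, MvPolynomial.comp_aeval]; rfl
  rw [h, comp_lawVec, W.aeval_toProjective_polynomial_eq_zero_iff]
  exact W.equation_law i (W.comp_lawP_ne_zero ψ) (W.equation_comp_lawP ψ) (W.comp_lawQ_ne_zero ψ)
    (W.equation_comp_lawQ ψ)

end LawVec

/-! ### The law charts -/

section Charts

variable (c d : Fin 3) (i : Fin 2) (e : Fin 3)

/-- The inverted element of the law chart `(c, d, i, e)`: the `e`-th coordinate of the `i`-th law on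
the piece `(c, d)`. [folklore] -/
abbrev lawDen : W.PieceRing c d := W.lawVec c d i e

/-- The coordinate ring `(A_c ⊗ A_d)[1/g]` of the source of the law chart. [folklore] -/
abbrev LawSrc : Type u := Localization.Away (W.lawDen c d i e)

/-- The localisation map as a `K`-algebra map. [folklore] -/
abbrev lawLoc : W.PieceRing c d →ₐ[K] W.LawSrc c d i e :=
  IsScalarTower.toAlgHom K (W.PieceRing c d) (W.LawSrc c d i e)

/-- The law vector on the source of the law chart (where its `e`-th coordinate is a unit). [folklore] -/
def lawV : Fin 3 → W.LawSrc c d i e := fun j ↦ algebraMap (W.PieceRing c d) (W.LawSrc c d i e) (W.lawVec c d i j)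

/-- `lawV = lawLoc ∘ lawVec`. [folklore] -/
theorem lawV_eq : W.lawV c d i e = fun j ↦ W.lawLoc c d i e (W.lawVec c d i j) := rfl

/-- `β ∘ lawV = (β ∘ lawLoc) ∘ lawVec`. [folklore] -/
theorem comp_lawV {B : Type u} [CommRing B] [Algebra K B] (β : W.LawSrc c d i e →ₐ[K] B) :
    β ∘ W.lawV c d i e = β.comp (W.lawLoc c d i e) ∘ W.lawVec c d i := rfl

/-- The `e`-th coordinate of `lawV` is a unit. [folklore] -/
theorem isUnit_aeval_lawV_X :
    IsUnit (aeval (W.lawV c d i e) (X e : MvPolynomial (Fin 3) K)) := by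
  rw [aeval_X]
  exact IsLocalization.Away.algebraMap_isUnit (W.lawDen c d i e)

variable [W.IsElliptic]

/-- `F(lawV) = 0`. [folklore] -/
theorem aeval_lawV : aeval (W.lawV c d i e) W.toProjective.polynomial = 0 := by
  rw [lawV_eq, ← MvPolynomial.comp_aeval, AlgHom.comp_apply, aeval_lawVec, map_zero]

/-- The `K`-algebra map `A_e → (A_c ⊗ A_d)[1/g]` of the law chart: the point of the chart `e` with
homogeneous coordinates `lawV` (`Motives/HypersurfaceCharts.liftVec`). [folklore] -/
def lawLift : W.CRing e →ₐ[K] W.LawSrc c d i e :=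
  SmoothHypersurface.liftVec (n := 1) W.toProjective.polynomial e W.toProjective.isHomogeneous_polynomial
    (W.lawV c d i e) (W.isUnit_aeval_lawV_X c d i e) (W.aeval_lawV c d i e)

/-- **The value morphism `Spec (A_c ⊗ A_d)[1/g] → Spec A_e → E_W`** of the law chart, over `K`.
[cite: SilvermanAEC2009, III.3.6] -/
def lawμ : specOver K (W.LawSrc c d i e) ⟶ W.scheme :=
  specOverOfAlgHom (W.lawLift c d i e) ≫ W.crChart e

omit [W.IsElliptic] in
/-- **The source immersion `Spec (A_c ⊗ A_d)[1/g] → Spec (A_c ⊗ A_d) → E_W ×_K E_W`**, over `K`. [folklore] -/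
def lawι : specOver K (W.LawSrc c d i e) ⟶ W.scheme ⊗ W.scheme :=
  specOverOfAlgHom (W.lawLoc c d i e) ≫ W.pieceι c d

omit [W.IsElliptic] in
/-- Underlying morphism of `lawι`. [folklore] -/
theorem lawι_left : (W.lawι c d i e).left =
    Spec.map (CommRingCat.ofHom (algebraMap (W.PieceRing c d) (W.LawSrc c d i e))) ≫ (W.pieceι c d).left :=
  rfl

omit [W.IsElliptic] in
/-- The source of a law chart is an open of `E_W ×_K E_W`. [folklore] -/
instance isOpenImmersion_lawι_left : IsOpenImmersion (W.lawι c d i e).left := by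
  rw [lawι_left]
  infer_instance

omit [W.IsElliptic] in
/-- At a field-valued point of the source of the law chart the law vector is non-zero (its `e`-th
coordinate is the image of a unit). [folklore] -/
theorem law_lawPt_ne_zero {L : Type u} [Field L] [Algebra K L] (β : W.LawSrc c d i e →ₐ[K] L) :
    W.law L i (β.comp (W.lawLoc c d i e) ∘ W.lawP c d) (β.comp (W.lawLoc c d i e) ∘ W.lawQ c d) ≠ 0 := by
  have hu : IsUnit (β (W.lawV c d i e e)) := (IsLocalization.Away.algebraMap_isUnit (W.lawDen c d i e)).map β
  rw [← comp_lawVec, ← comp_lawV]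
  exact Function.ne_iff.mpr ⟨e, hu.ne_zero⟩

/-- At a field-valued point of the source the law vector satisfies the Weierstrass equation. [folklore] -/
theorem equation_law_lawPt {L : Type u} [Field L] [Algebra K L] (β : W.LawSrc c d i e →ₐ[K] L) :
    (W.baseChange L).toProjective.Equation
      (W.law L i (β.comp (W.lawLoc c d i e) ∘ W.lawP c d) (β.comp (W.lawLoc c d i e) ∘ W.lawQ c d)) :=
  W.equation_law i (W.comp_lawP_ne_zero _) (W.equation_comp_lawP _) (W.comp_lawQ_ne_zero _)
    (W.equation_comp_lawQ _)

set_option maxHeartbeats 800000 in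
-- the comparison of the lifted vector with the law vector goes through several `AlgHom` coercions
/-- **The value of the law chart at a field-valued point `β` is `[law i (P_β) (Q_β)]`.** [folklore] -/
theorem specOverOfAlgHom_comp_lawμ {L : Type u} [Field L] [Algebra K L] (β : W.LawSrc c d i e →ₐ[K] L) :
    specOverOfAlgHom β ≫ W.lawμ c d i e =
      W.schemePoint (W.law L i (β.comp (W.lawLoc c d i e) ∘ W.lawP c d) (β.comp (W.lawLoc c d i e) ∘ W.lawQ c d))
        (W.law_lawPt_ne_zero c d i e β) (W.equation_law_lawPt c d i e β) := by
  set hv := W.isUnit_aeval_lawV_X c d i e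
  have hval : (↑hv.unit : W.LawSrc c d i e) = W.lawV c d i e e := by rw [IsUnit.unit_spec, aeval_X]
  have hc : β ↑hv.unit ≠ 0 := (hv.unit.isUnit.map β).ne_zero
  rw [lawμ, ← Category.assoc, ← specOverOfAlgHom_comp, specOverOfAlgHom_comp_crChart]
  refine (W.schemePoint_eq_schemePoint_iff _ _ _ _ _ _).mpr ⟨β ↑hv.unit, hc, ?_⟩
  rw [← comp_lawVec, ← comp_lawV]
  funext j
  rw [Pi.smul_apply, smul_eq_mul, Function.comp_apply, AlgHom.comp_apply, lawLift,
    SmoothHypersurface.liftVec_tautVec, map_mul, ← mul_assoc, mul_comm (β ↑hv.unit), mul_assoc, ← map_mul,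
    Units.mul_inv, map_one, mul_one]

omit [W.IsElliptic] in
/-- First projection of a `K̄`-point of the source of a law chart. [folklore] -/
theorem specOverOfAlgHom_comp_lawι_fst {L : Type u} [Field L] [Algebra K L] (β : W.LawSrc c d i e →ₐ[K] L) :
    specOverOfAlgHom β ≫ W.lawι c d i e ≫ fst _ _ =
      W.schemePoint (β.comp (W.lawLoc c d i e) ∘ W.lawP c d) (W.comp_lawP_ne_zero _) (W.equation_comp_lawP _) := by
  rw [lawι, ← Category.assoc, ← Category.assoc, ← specOverOfAlgHom_comp, Category.assoc]
  exact W.specOverOfAlgHom_pieceι_fst c d _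

omit [W.IsElliptic] in
/-- Second projection of a `K̄`-point of the source of a law chart. [folklore] -/
theorem specOverOfAlgHom_comp_lawι_snd {L : Type u} [Field L] [Algebra K L] (β : W.LawSrc c d i e →ₐ[K] L) :
    specOverOfAlgHom β ≫ W.lawι c d i e ≫ snd _ _ =
      W.schemePoint (β.comp (W.lawLoc c d i e) ∘ W.lawQ c d) (W.comp_lawQ_ne_zero _) (W.equation_comp_lawQ _) := by
  rw [lawι, ← Category.assoc, ← Category.assoc, ← specOverOfAlgHom_comp, Category.assoc]
  exact W.specOverOfAlgHom_pieceι_snd c d _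

omit [W.IsElliptic] in
/-- `specPoint` of an `Over`-morphism's underlying map is composition with it. [folklore] -/
theorem specPoint_left_eq {X : SchemeOver K} {S : Type u} [CommRing S] [Algebra K S]
    (f : specOver K S ⟶ X) {L : Type u} [Field L] [Algebra K L] (β : S →ₐ[K] L) :
    specPoint f.left (Over.w f) β = specOverOfAlgHom β ≫ f :=
  Over.OverMorphism.ext rfl

/-- **The law chart `(c, d, i, e)` of the addition of `E_W`** (`EllipticCurves/WeierstrassAddAtlas.LawChart`):
on `K̄`-points its value is `pr₁ + pr₂`. [cite: SilvermanAEC2009, III.3.6] -/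
def lawChart : W.LawChart where
  S := W.LawSrc c d i e
  ι := (W.lawι c d i e).left
  ι_over := Over.w _
  μ := (W.lawμ c d i e).left
  μ_over := Over.w _
  isAddition β := by
    rw [specPoint_left_eq, specPoint_left_eq, specOverOfAlgHom_comp_lawμ, Category.assoc,
      specOverOfAlgHom_comp_lawι_fst, Category.assoc, specOverOfAlgHom_comp_lawι_snd]
    exact W.toGeomPoint_schemePoint_law i _ _ _ _ _ _

/-- The source immersion of `lawChart` (`rfl`). [folklore] -/
theorem lawChart_ι : (W.lawChart c d i e).ι = (W.lawι c d i e).left := rfl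

end Charts

/-! ### The law charts cover `E_W ×_K E_W` -/

section Cover

variable [W.IsElliptic]

/-- **At every point of a piece some coordinate of some law is a unit nearby** (completeness of the two
laws in the residue field; Bosma–Lenstra 1995, Theorem 2). [cite: BosmaLenstra1995, Theorem 2] -/
theorem exists_lawDen_not_mem (c d : Fin 3) (𝔭 : PrimeSpectrum (W.PieceRing c d)) :
    ∃ (i : Fin 2) (e : Fin 3), W.lawDen c d i e ∉ 𝔭.asIdeal := by
  set ψ := ProjectiveSpace.toResidueDomainField K 𝔭
  obtain ⟨i, hi⟩ := W.exists_law_ne_zero (W.comp_lawP_ne_zero ψ) (W.equation_comp_lawP ψ)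
    (W.comp_lawQ_ne_zero ψ) (W.equation_comp_lawQ ψ)
  rw [← comp_lawVec] at hi
  obtain ⟨e, he⟩ := Function.ne_iff.mp hi
  refine ⟨i, e, fun hmem ↦ he ?_⟩
  rw [Function.comp_apply, Pi.zero_apply]
  exact (ProjectiveSpace.toResidueDomainField_eq_zero_iff (k := K) 𝔭 _).mpr hmem

/-- **The law charts cover `E_W ×_K E_W`.** [cite: SilvermanAEC2009, III.3.6] -/
theorem lawCharts_cover (x : (W.scheme ⊗ W.scheme).left) :
    ∃ (j : Fin 3 × Fin 3 × Fin 2 × Fin 3) (y : Spec (CommRingCat.of (W.lawChart j.1 j.2.1 j.2.2.1 j.2.2.2).S)),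
      (W.lawChart j.1 j.2.1 j.2.2.1 j.2.2.2).ι y = x := by
  obtain ⟨c, d, q, rfl⟩ := W.exists_mem_range_pieceι x
  obtain ⟨i, e, he⟩ := W.exists_lawDen_not_mem c d q
  have hq : q ∈ Set.range (PrimeSpectrum.comap (algebraMap (W.PieceRing c d) (W.LawSrc c d i e))) := by
    rw [PrimeSpectrum.localization_away_comap_range (W.LawSrc c d i e) (W.lawDen c d i e)]
    exact he
  obtain ⟨y, hy⟩ := hq
  refine ⟨(c, d, i, e), y, ?_⟩
  change (Spec.map (CommRingCat.ofHom (algebraMap (W.PieceRing c d) (W.LawSrc c d i e))) ≫ (W.pieceι c d).left) y =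
    (W.pieceι c d).left q
  rw [Scheme.Hom.comp_apply]
  congr 1

/-- **The atlas of law charts of `E_W`.** [cite: SilvermanAEC2009, III.3.6] -/
def addAtlas : W.AddAtlas (Fin 3 × Fin 3 × Fin 2 × Fin 3) where
  chart j := W.lawChart j.1 j.2.1 j.2.2.1 j.2.2.2
  covers := W.lawCharts_cover

/-- **The addition morphism `E_W ×_K E_W → E_W` over `K`** (Silverman, *AEC* III.3.6), glued from the
law charts. [cite: SilvermanAEC2009, III.3.6] -/
def addHom : W.scheme ⊗ W.scheme ⟶ W.scheme := W.addAtlas.addHom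

/-- **`⟨[P], [Q]⟩ ≫ addHom = [P + Q]` on `K̄`-points** (the hypothesis `hadd` of
`EllipticCurves/AbelianVarietyModelOfAddHom`). [cite: SilvermanAEC2009, III.3.6] -/
theorem lift_pointEquiv_comp_addHom (P Q : W.geomPoints) :
    lift (W.pointEquiv (L := AlgebraicClosure K) P) (W.pointEquiv (L := AlgebraicClosure K) Q) ≫ W.addHom =
      W.pointEquiv (L := AlgebraicClosure K) (P + Q) :=
  W.addAtlas.lift_pointEquiv_comp_addHom P Q

end Cover

end WeierstrassCurve
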